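import Summits.CriticalPhenomena.PercolationContinuityZ3.Theorems.SubpolynomialBlocking.Negative.Strengthenings
import Literature.Probability.Percolation.BernoulliPercolationProofs
import HarnessLib

/-!
# Crux `PercNonProliferation.SubpolynomialBlocking` (stmt-CriticalPhenomena-4446), line `root-trick-wall-patch` — stub `stub_critAnnulusCrossing_pos`

Helper file for the lead's skeleton of the line `root-trick-wall-patch` of the crux
`Summit.CriticalPhenomena.PercolationContinuityZ3.Theses.PercNonProliferation.SubpolynomialBlocking`.
Proves exactly the registered stub signature `stub_critAnnulusCrossing_pos`; lands with
`--supports stmt-CriticalPhenomena-4446`.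

## The statement (critical annulus crossing `a_n(p_c) ≥ c > 0`, from renormalisation)

Write `a_n(p) = P_p(annulusCrossing d n) = P_p(Λ_n ⟷ ∂ⁱⁿΛ_{2n} in Λ_{2n})` on `ℤ^d`. ASSUMING the
renormalisation inequality `a_{20n}(p) ≤ (100^d · a_n(p))²` (`d ≥ 1`, `n ≥ 1`, every `p`; it is the
neighbouring stub `stub_annulusCrossing_renorm`, taken here as a hypothesis), for every `d ≥ 2`
there is `c > 0` with `c ≤ a_n(p_c(ℤ^d))` for all `n ≥ 1` (so the critical blocking probability is
`u_n ≤ 1 - c`).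

## The argument (by contradiction; no `θ(p_c)` needed)

Put `K = 100^d`, `b_n(p) = K² a_n(p)`; the hypothesis reads `b_{20n}(p) ≤ b_n(p)²` (`n ≥ 1`). If the
conclusion fails, some `m ≥ 1` has `a_m(p_c) < 1/K²`. The event `annulusCrossing d m` is the open
crossing event of the finite box `Λ_{2m}` (definitionally), hence determined by the pairs of
`Λ_{2m}` (`PlanarDuality.determinedBy_openCrossing`), so `p ↦ a_m(p)` is continuous on `[0,1]`
(`continuous_bondPercolation_real_of_determinedBy`); as `p_c < 1` (`criticalProb_zd_lt_one`) there is
`p > p_c` in `[0,1]` with `a_m(p) < 1/K²`, i.e. `b_m(p) < 1`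
(`StubCritAnnulusCrossingPos.exists_gt_of_continuous`). Iterating, `b_{20^k m}(p) ≤ b_m(p)^{2^k} ≤ b_m(p)^k → 0`.
But `p > p_c` gives `θ(p) > 0` (`theta_pos_of_criticalProb_lt_holds`) and
`θ(p) ≤ P_p(0 ⟷ ∂Λ_{2N}) ≤ a_N(p)` for every `N` (`DCT16.theta_le_real_siteToBoundary`,
`Negative.real_siteToBoundary_le_real_annulusCrossing`): `0 < K²θ(p) ≤ b_{20^k m}(p) < K²θ(p)` for `k`
large — contradiction (`StubCritAnnulusCrossingPos.no_small_scale`, pure real analysis).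

No new definitions; all sets are written exactly as in the registered signature.
-/

noncomputable section

namespace Summit.CriticalPhenomena.PercolationContinuityZ3.Theorems.SubpolynomialBlocking

open MeasureTheory Filter Topology
open Literature.Probability.Percolation Literature.Probability.LatticeModels
open Literature.Barriers.CriticalPhenomena
open Literature.Probability.Percolation.DCT16
open Summit.CriticalPhenomena.PercolationContinuityZ3.Theorems.SubpolynomialBlocking.Negative

namespace StubCritAnnulusCrossingPos

/-- **Real-analysis core (renormalisation vs. a positive floor).** If `a : ℕ → ℝ` is nonnegative,
bounded below by `θ > 0` at every scale `n ≥ 1`, satisfies `a (20 n) ≤ (K a n)²` for `n ≥ 1`, and is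
small at one scale, `a m < 1/K²` (`m ≥ 1`), we reach a contradiction: with `b n = K² a n`,
`b (20^k m) ≤ (b m)^{2^k} ≤ (b m)^k < K² θ ≤ b (20^k m)` for `k` large. -/
theorem no_small_scale {a : ℕ → ℝ} {K θ : ℝ} (hK : 0 < K) (hθ : 0 < θ)
    (ha0 : ∀ n, 0 ≤ a n) (hθa : ∀ n, 1 ≤ n → θ ≤ a n)
    (hren : ∀ n, 1 ≤ n → a (20 * n) ≤ (K * a n) ^ 2)
    {m : ℕ} (hm : 1 ≤ m) (hsmall : a m < 1 / K ^ 2) : False := by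
  -- `b n := K² a n` satisfies `b (20 n) ≤ (b n)²`
  have hb0 : ∀ n, 0 ≤ K ^ 2 * a n := fun n => mul_nonneg (pow_nonneg hK.le 2) (ha0 n)
  have hstep : ∀ n, 1 ≤ n → K ^ 2 * a (20 * n) ≤ (K ^ 2 * a n) ^ 2 := fun n hn =>
    calc K ^ 2 * a (20 * n) ≤ K ^ 2 * (K * a n) ^ 2 :=
          mul_le_mul_of_nonneg_left (hren n hn) (pow_nonneg hK.le 2)
      _ = (K ^ 2 * a n) ^ 2 := by ring
  -- iteration along the scales `20^k m`
  have hiter : ∀ k : ℕ, K ^ 2 * a (20 ^ k * m) ≤ (K ^ 2 * a m) ^ 2 ^ k := by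
    intro k
    induction k with
    | zero => simp
    | succ k ih =>
      have hkm : 1 ≤ 20 ^ k * m := Nat.succ_le_of_lt (by positivity)
      calc K ^ 2 * a (20 ^ (k + 1) * m) = K ^ 2 * a (20 * (20 ^ k * m)) := by
            rw [show 20 ^ (k + 1) * m = 20 * (20 ^ k * m) by ring]
        _ ≤ (K ^ 2 * a (20 ^ k * m)) ^ 2 := hstep _ hkm
        _ ≤ ((K ^ 2 * a m) ^ 2 ^ k) ^ 2 := pow_le_pow_left₀ (hb0 _) ih 2
        _ = (K ^ 2 * a m) ^ 2 ^ (k + 1) := by rw [← pow_mul, ← pow_succ]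
  have hb1 : K ^ 2 * a m < 1 := by
    calc K ^ 2 * a m < K ^ 2 * (1 / K ^ 2) := mul_lt_mul_of_pos_left hsmall (by positivity)
      _ = 1 := mul_one_div_cancel (pow_ne_zero 2 hK.ne')
  have hKθ : 0 < K ^ 2 * θ := by positivity
  obtain ⟨k, hk⟩ := exists_pow_lt_of_lt_one hKθ hb1
  have hkm : 1 ≤ 20 ^ k * m := Nat.succ_le_of_lt (by positivity)
  have h1 : K ^ 2 * θ ≤ K ^ 2 * a (20 ^ k * m) :=
    mul_le_mul_of_nonneg_left (hθa _ hkm) (pow_nonneg hK.le 2)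
  have h2 : (K ^ 2 * a m) ^ 2 ^ k ≤ (K ^ 2 * a m) ^ k :=
    pow_le_pow_of_le_one (hb0 m) hb1.le Nat.lt_two_pow_self.le
  linarith [hiter k]

/-- **One-sided openness in the parameter.** For a continuous `f : [0,1] → ℝ`, a point `p₀ < 1` of
`[0,1]` and `f p₀ < c`, there is `p ∈ [0,1]` with `p₀ < p` and `f p < c` (metric continuity at `p₀`
and the point `min (p₀ + δ/2, (p₀ + 1)/2)`). -/
theorem exists_gt_of_continuous {f : unitInterval → ℝ} (hf : Continuous f) {p₀ : unitInterval}
    (hp₀ : (p₀ : ℝ) < 1) {c : ℝ} (hc : f p₀ < c) :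
    ∃ p : unitInterval, (p₀ : ℝ) < p ∧ f p < c := by
  obtain ⟨δ, hδ, h⟩ := Metric.continuous_iff.1 hf p₀ (c - f p₀) (sub_pos.2 hc)
  set q : ℝ := min ((p₀ : ℝ) + δ / 2) (((p₀ : ℝ) + 1) / 2) with hq
  have hp₀0 : 0 ≤ (p₀ : ℝ) := p₀.2.1
  have hq0 : (p₀ : ℝ) < q := lt_min (by linarith) (by linarith)
  have hq01 : q ∈ unitInterval := ⟨by linarith, (min_le_right _ _).trans (by linarith)⟩
  refine ⟨⟨q, hq01⟩, hq0, ?_⟩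
  have hdist : dist (⟨q, hq01⟩ : unitInterval) p₀ < δ := by
    rw [Subtype.dist_eq, Real.dist_eq]
    show |q - (p₀ : ℝ)| < δ
    rw [abs_of_pos (sub_pos.2 hq0)]
    have : q ≤ (p₀ : ℝ) + δ / 2 := min_le_left _ _
    linarith
  have hlt := h ⟨q, hq01⟩ hdist
  rw [Real.dist_eq] at hlt
  linarith [(abs_lt.1 hlt).2]

end StubCritAnnulusCrossingPos

/-- **Registered stub `stub_critAnnulusCrossing_pos`** (line `root-trick-wall-patch`, crux
`SubpolynomialBlocking`): the in-print UPPER side of the critical blocking probability, derived from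
the renormalisation inequality. If `a_{20n}(p) ≤ (100^d a_n(p))²` for all `d ≥ 1`, `n ≥ 1`, `p`
(`a_n(p) = P_p(Λ_n ⟷ ∂ⁱⁿΛ_{2n} in Λ_{2n})` on `ℤ^d`), then for every `d ≥ 2` there is `c > 0` with
`c ≤ a_n(p_c(ℤ^d))` for all `n ≥ 1`. Proof: otherwise some `a_m(p_c) < 100^{-2d}`; by continuity of
`p ↦ a_m(p)` (a local increasing event of `Λ_{2m}`) and `p_c < 1` the same holds at some `p > p_c`,
and iterating the renormalisation inequality drives `a_{20^k m}(p) → 0`, contradicting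
`0 < θ(p) ≤ a_N(p)` (`StubCritAnnulusCrossingPos.no_small_scale`). -/
theorem stub_critAnnulusCrossing_pos : (∀ (d : ℕ) (p : unitInterval) (n : ℕ), 1 ≤ d → 1 ≤ n → (bondPercolation (zdGraph d) p).real (Literature.Barriers.CriticalPhenomena.annulusCrossing d (20 * n)) ≤ ((100 : ℝ) ^ d * (bondPercolation (zdGraph d) p).real (Literature.Barriers.CriticalPhenomena.annulusCrossing d n)) ^ 2) → ∀ d : ℕ, 2 ≤ d → ∃ c : ℝ, 0 < c ∧ ∀ n : ℕ, 1 ≤ n → c ≤ (bondPercolation (zdGraph d) (criticalProbI d)).real (Literature.Barriers.CriticalPhenomena.annulusCrossing d n) := by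
  intro hren d hd
  have hd1 : 1 ≤ d := le_trans one_le_two hd
  have hK : (0 : ℝ) < (100 : ℝ) ^ d := by positivity
  by_contra hcon
  push Not at hcon
  obtain ⟨m, hm, hsmall⟩ := hcon (1 / ((100 : ℝ) ^ d) ^ 2) (by positivity)
  -- `p ↦ P_p(annulusCrossing d m)` is continuous: a local event of the finite box `Λ_{2m}`
  have hcont : Continuous fun p : unitInterval =>
      (bondPercolation (zdGraph d) p).real (annulusCrossing d m) :=
    continuous_bondPercolation_real_of_determinedBy (zdGraph d)
      (PlanarDuality.determinedBy_openCrossing (box d (2 * m)) (↑(box d m) : Set (Site d))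
        (↑(innerBoundary (zdGraph d) (box d (2 * m))) : Set (Site d)))
  -- a supercritical `p > p_c` at which scale `m` is still small
  obtain ⟨p, hpc, hpm⟩ := StubCritAnnulusCrossingPos.exists_gt_of_continuous hcont
    (p₀ := criticalProbI d) (criticalProb_zd_lt_one hd) hsmall
  have hθ : 0 < theta (zdGraph d) (0 : Site d) p :=
    theta_pos_of_criticalProb_lt_holds (zdGraph d) (0 : Site d) p hpc
  exact StubCritAnnulusCrossingPos.no_small_scale hK hθ (fun n => measureReal_nonneg)
    (fun n _ => (theta_le_real_siteToBoundary p (2 * n)).trans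
      (real_siteToBoundary_le_real_annulusCrossing d p n))
    (fun n hn => hren d p n hd1 hn) hm hpm

end Summit.CriticalPhenomena.PercolationContinuityZ3.Theorems.SubpolynomialBlocking

end
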